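import Literature.NumberTheory.LFunctions.SiegelTatuzawaHoffsteinLemma
import HarnessLib

/-!
# `L(1, χ) > 1/(1.502 log q)` and `h_K > √|d_K|/(1.502 π log|d_K|)` on certified ranges — Hoffstein-free

Topic `Literature/NumberTheory/LFunctions`. The readings of `SiegelTatuzawaExplicit.lean`
(namespace `SiegelTatuzawa`) that took Hoffstein's Lemma 1 as the hypothesis
`(hH : hoffstein1980_lemma1)` are restated here with that hypothesis DISCHARGED by
`hoffstein1980_lemma1_holds` (file `SiegelTatuzawaHoffsteinLemma.lean`, the formalization of the printed
proof, Acta Arith. 38 (1980) pp. 168–169). The only remaining inputs are the certified-range statements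
`NoRealZeroUpTo Q` / the ladder leaves (`RealCharacterLadderLeaves.lean`), resp. Lu–Zaman–Zhao's
Theorem 1.1 (`luZamanZhao2026_theorem11`) where the source's own deduction uses it. Every proof is the
one-line instantiation of the corresponding `SiegelTatuzawa.*` theorem at `hoffstein1980_lemma1_holds`.

## References

* J. Hoffstein, On the Siegel–Tatuzawa theorem, Acta Arith. 38 (1980) 167–174, Lemma 1 p. 168 and
  (17) p. 173. [Hoffstein1980SiegelTatuzawa]
* Lu–Zaman–Zhao (2026), Corollary 1.3. [LuZamanZhao2026]
* J. Neukirch, Algebraic Number Theory (1999), Ch. VII §5 (5.11). [NeukirchANT1999]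
-/

noncomputable section

open Complex

namespace Literature.NumberTheory.LFunctions.SiegelTatuzawa

/-- **Hoffstein's inequality on a certified range, Hoffstein-free:** if `NoRealZeroUpTo Q` then every
primitive quadratic `χ` mod `q` with `10⁶ < q ≤ Q` has **`L(1, χ) > 1/(1.502 log q)`**.
[cite: Hoffstein1980SiegelTatuzawa, Lemma 1 p. 168] -/
theorem lOne_gt_of_noRealZeroUpTo' {Q : ℕ} (hZ : NoRealZeroUpTo Q)
    {q : ℕ} [NeZero q] (hq : (10 ^ 6 : ℝ) < q) (hqQ : q ≤ Q)
    (χ : DirichletCharacter ℂ q) (hprim : χ.IsPrimitive) (hquad : χ.IsQuadratic) :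
    1 / (1.502 * Real.log q) < (χ.LFunction 1).re :=
  lOne_gt_of_noRealZeroUpTo hoffstein1980_lemma1_holds hZ hq hqQ χ hprim hquad

/-- The leaf `NoRealZeroUpTo_1e10` gives `L(1, χ) > 1/(1.502 log q)` for `10⁶ < q ≤ 10¹⁰`
(Hoffstein-free). [cite: Hoffstein1980SiegelTatuzawa, Lemma 1 p. 168] -/
theorem lOne_gt_of_leaf_1e10' (hZ : NoRealZeroUpTo_1e10)
    {q : ℕ} [NeZero q] (hq : (10 ^ 6 : ℝ) < q) (hqQ : q ≤ 10 ^ 10)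
    (χ : DirichletCharacter ℂ q) (hprim : χ.IsPrimitive) (hquad : χ.IsQuadratic) :
    1 / (1.502 * Real.log q) < (χ.LFunction 1).re :=
  lOne_gt_of_leaf_1e10 hoffstein1980_lemma1_holds hZ hq hqQ χ hprim hquad

/-- Odd characters on the odd rung `NoRealZeroOddUpTo_3e10`: `L(1, χ) > 1/(1.502 log q)` for
`10⁶ < q ≤ 3·10¹⁰` (Hoffstein-free). [cite: Hoffstein1980SiegelTatuzawa, Lemma 1 p. 168] -/
theorem lOne_gt_of_leaf_odd_3e10' (hZ : NoRealZeroOddUpTo_3e10)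
    {q : ℕ} [NeZero q] (hq : (10 ^ 6 : ℝ) < q) (hqQ : q ≤ 3 * 10 ^ 10)
    (χ : DirichletCharacter ℂ q) (hprim : χ.IsPrimitive) (hquad : χ.IsQuadratic) (hodd : χ.Odd) :
    1 / (1.502 * Real.log q) < (χ.LFunction 1).re :=
  lOne_gt_of_leaf_odd_3e10 hoffstein1980_lemma1_holds hZ hq hqQ χ hprim hquad hodd

/-- Even characters on the even rung `NoRealZeroEvenUpTo_3e10`: `L(1, χ) > 1/(1.502 log q)` for
`10⁶ < q ≤ 3·10¹⁰` (Hoffstein-free). [cite: Hoffstein1980SiegelTatuzawa, Lemma 1 p. 168] -/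
theorem lOne_gt_of_leaf_even_3e10' (hZ : NoRealZeroEvenUpTo_3e10)
    {q : ℕ} [NeZero q] (hq : (10 ^ 6 : ℝ) < q) (hqQ : q ≤ 3 * 10 ^ 10)
    (χ : DirichletCharacter ℂ q) (hprim : χ.IsPrimitive) (hquad : χ.IsQuadratic) (heven : χ.Even) :
    1 / (1.502 * Real.log q) < (χ.LFunction 1).re :=
  lOne_gt_of_leaf_even_3e10 hoffstein1980_lemma1_holds hZ hq hqQ χ hprim hquad heven

/-- Both parities on the wide leaf `NoRealZeroUpTo_3e10`: `L(1, χ) > 1/(1.502 log q)` for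
`10⁶ < q ≤ 3·10¹⁰` (Hoffstein-free). [cite: Hoffstein1980SiegelTatuzawa, Lemma 1 p. 168] -/
theorem lOne_gt_of_leaf_3e10' (hZ : NoRealZeroUpTo_3e10)
    {q : ℕ} [NeZero q] (hq : (10 ^ 6 : ℝ) < q) (hqQ : q ≤ 3 * 10 ^ 10)
    (χ : DirichletCharacter ℂ q) (hprim : χ.IsPrimitive) (hquad : χ.IsQuadratic) :
    1 / (1.502 * Real.log q) < (χ.LFunction 1).re :=
  lOne_gt_of_leaf_3e10 hoffstein1980_lemma1_holds hZ hq hqQ χ hprim hquad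

/-- **Lu–Zaman–Zhao's Corollary 1.3 above `10⁶`, as printed, now modulo Theorem 1.1 only:**
`L(1, χ) > 1/(7.74 log q)` for every primitive quadratic `χ` mod `q`, `10⁶ < q ≤ 10¹⁰`
(Theorem 1.1 clears the window, Hoffstein's Lemma 1 — proved — gives the value).
[cite: LuZamanZhao2026, Corollary 1.3 (proof)] [cite: Hoffstein1980SiegelTatuzawa, Lemma 1 p. 168] -/
theorem lOne_gt_of_luZamanZhao' (hL : luZamanZhao2026_theorem11)
    {q : ℕ} [NeZero q] (hq : (10 ^ 6 : ℝ) < q) (hqQ : q ≤ 10 ^ 10)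
    (χ : DirichletCharacter ℂ q) (hprim : χ.IsPrimitive) (hquad : χ.IsQuadratic) :
    1 / (7.74 * Real.log q) < (χ.LFunction 1).re :=
  lOne_gt_of_luZamanZhao hL hoffstein1980_lemma1_holds hq hqQ χ hprim hquad

/-- `L(1, χ) ≥ 1/(8 log q)` on `10⁶ < q ≤ 10¹⁰` modulo `luZamanZhao2026_theorem11` only (the part of
`luZamanZhao2026_corollary13` above `10⁶`). [cite: LuZamanZhao2026, Corollary 1.3] -/
theorem corollary13_above_1e6' (hL : luZamanZhao2026_theorem11)
    {q : ℕ} [NeZero q] (hq : (10 ^ 6 : ℝ) < q) (hqQ : q ≤ 10 ^ 10)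
    (χ : DirichletCharacter ℂ q) (hquad : χ.IsQuadratic) (hprim : χ.IsPrimitive) :
    1 / (8 * Real.log q) ≤ (χ.LFunction 1).re :=
  corollary13_above_1e6 hL hoffstein1980_lemma1_holds hq hqQ χ hquad hprim

/-- **Class-number reading, Hoffstein-free:** a certified table `NoRealZeroUpTo Q` gives, for every
imaginary quadratic field `K` with `10⁶ < |d_K| ≤ Q`, **`h_K > √|d_K|/(1.502 π log|d_K|)`**.
[cite: Hoffstein1980SiegelTatuzawa, Lemma 1 p. 168 and (17) p. 173]
[cite: NeukirchANT1999, Ch. VII §5 (5.11)] -/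
theorem classNumber_gt_of_noRealZeroUpTo' {Q : ℕ} (hZ : NoRealZeroUpTo Q)
    (K : Type) [Field K] [NumberField K] (h2 : Module.finrank ℚ K = 2) (hd : NumberField.discr K < 0)
    (hD : (10 ^ 6 : ℝ) < (NumberField.discr K).natAbs) (hDQ : (NumberField.discr K).natAbs ≤ Q) :
    Real.sqrt ((NumberField.discr K).natAbs : ℝ) /
        (1.502 * Real.pi * Real.log ((NumberField.discr K).natAbs : ℝ)) <
      (NumberField.classNumber K : ℝ) :=
  classNumber_gt_of_noRealZeroUpTo hoffstein1980_lemma1_holds hZ K h2 hd hD hDQ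

/-- The leaf instance, Hoffstein-free: `NoRealZeroUpTo_1e10` ⇒ `h_K > √|d_K|/(1.502 π log|d_K|)` for every
imaginary quadratic `K` with `10⁶ < |d_K| ≤ 10¹⁰`.
[cite: Hoffstein1980SiegelTatuzawa, Lemma 1 p. 168 and (17) p. 173] -/
theorem classNumber_gt_of_leaf_1e10' (hZ : NoRealZeroUpTo_1e10)
    (K : Type) [Field K] [NumberField K] (h2 : Module.finrank ℚ K = 2) (hd : NumberField.discr K < 0)
    (hD : (10 ^ 6 : ℝ) < (NumberField.discr K).natAbs) (hDQ : (NumberField.discr K).natAbs ≤ 10 ^ 10) :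
    Real.sqrt ((NumberField.discr K).natAbs : ℝ) /
        (1.502 * Real.pi * Real.log ((NumberField.discr K).natAbs : ℝ)) <
      (NumberField.classNumber K : ℝ) :=
  classNumber_gt_of_leaf_1e10 hoffstein1980_lemma1_holds hZ K h2 hd hD hDQ

/-- Class-number form on the wide leaf at `3·10¹⁰`, Hoffstein-free: `h_K > √|d_K|/(1.502 π log|d_K|)`
for imaginary quadratic `K` with `10⁶ < |d_K| ≤ 3·10¹⁰`.
[cite: Hoffstein1980SiegelTatuzawa, Lemma 1 p. 168 and (17) p. 173] -/
theorem classNumber_gt_of_leaf_3e10' (hZ : NoRealZeroUpTo_3e10)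
    (K : Type) [Field K] [NumberField K] (h2 : Module.finrank ℚ K = 2)
    (hneg : NumberField.discr K < 0) (hd : (10 ^ 6 : ℝ) < (NumberField.discr K).natAbs)
    (hdQ : (NumberField.discr K).natAbs ≤ 3 * 10 ^ 10) :
    Real.sqrt (NumberField.discr K).natAbs / (1.502 * Real.pi * Real.log (NumberField.discr K).natAbs) <
      (NumberField.classNumber K : ℝ) :=
  classNumber_gt_of_leaf_3e10 hoffstein1980_lemma1_holds hZ K h2 hneg hd hdQ

/-! ### Generic parity forms and the by-name instances for the segment leaves `4·10¹⁰ … 10¹¹`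
(ENVELOPE-G/H/I of the cell `parity-realchar`; appended 2026-08-28). All Hoffstein-free; the only input is
the leaf. -/

/-- **Odd characters, any certified odd range:** if `NoRealZeroOddUpTo Q` then every primitive quadratic ODD
`χ` mod `q` with `10⁶ < q ≤ Q` has `L(1, χ) > 1/(1.502 log q)` (Hoffstein-free; the odd column of the
instrument suffices for imaginary-quadratic consumers). [cite: Hoffstein1980SiegelTatuzawa, Lemma 1 p. 168] -/
theorem lOne_gt_of_noRealZeroOddUpTo' {Q : ℕ} (hZ : NoRealZeroOddUpTo Q)
    {q : ℕ} [NeZero q] (hq : (10 ^ 6 : ℝ) < q) (hqQ : q ≤ Q)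
    (χ : DirichletCharacter ℂ q) (hprim : χ.IsPrimitive) (hquad : χ.IsQuadratic) (hodd : χ.Odd) :
    1 / (1.502 * Real.log q) < (χ.LFunction 1).re := by
  have hq3 : 3 ≤ q := by
    by_contra h
    push Not at h
    have : (q : ℝ) < 3 := by exact_mod_cast h
    linarith
  have hne : χ ≠ 1 := SiegelZeroQuality.ne_one_of_isPrimitive hprim (by omega)
  exact (hoffstein1980_lemma1_holds q χ hprim hquad hne hq).2
    (fun σ hσ0 hσ1 ↦ hZ q hq3 hqQ χ hquad hprim hodd σ hσ0 hσ1)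

/-- **Even characters, any certified even range:** if `NoRealZeroEvenUpTo Q` then every primitive quadratic
EVEN `χ` mod `q` with `10⁶ < q ≤ Q` has `L(1, χ) > 1/(1.502 log q)` (Hoffstein-free).
[cite: Hoffstein1980SiegelTatuzawa, Lemma 1 p. 168] -/
theorem lOne_gt_of_noRealZeroEvenUpTo' {Q : ℕ} (hZ : NoRealZeroEvenUpTo Q)
    {q : ℕ} [NeZero q] (hq : (10 ^ 6 : ℝ) < q) (hqQ : q ≤ Q)
    (χ : DirichletCharacter ℂ q) (hprim : χ.IsPrimitive) (hquad : χ.IsQuadratic) (heven : χ.Even) :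
    1 / (1.502 * Real.log q) < (χ.LFunction 1).re := by
  have hq3 : 3 ≤ q := by
    by_contra h
    push Not at h
    have : (q : ℝ) < 3 := by exact_mod_cast h
    linarith
  have hne : χ ≠ 1 := SiegelZeroQuality.ne_one_of_isPrimitive hprim (by omega)
  exact (hoffstein1980_lemma1_holds q χ hprim hquad hne hq).2
    (fun σ hσ0 hσ1 ↦ hZ q hq3 hqQ χ hquad hprim heven σ hσ0 hσ1)

/-- The segment leaf `NoRealZeroUpTo_4e10` (ENVELOPE-G, booked level of the instrument) gives
`L(1, χ) > 1/(1.502 log q)` for `10⁶ < q ≤ 4·10¹⁰`. [cite: Hoffstein1980SiegelTatuzawa, Lemma 1 p. 168] -/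
theorem lOne_gt_of_leaf_4e10' (hZ : NoRealZeroUpTo_4e10)
    {q : ℕ} [NeZero q] (hq : (10 ^ 6 : ℝ) < q) (hqQ : q ≤ 4 * 10 ^ 10)
    (χ : DirichletCharacter ℂ q) (hprim : χ.IsPrimitive) (hquad : χ.IsQuadratic) :
    1 / (1.502 * Real.log q) < (χ.LFunction 1).re :=
  lOne_gt_of_noRealZeroUpTo' hZ hq (by norm_num at hqQ ⊢; exact hqQ) χ hprim hquad

/-- The segment leaf `NoRealZeroUpTo_5e10` (ENVELOPE-H, route I's closes-target) gives
`L(1, χ) > 1/(1.502 log q)` for `10⁶ < q ≤ 5·10¹⁰`. [cite: Hoffstein1980SiegelTatuzawa, Lemma 1 p. 168] -/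
theorem lOne_gt_of_leaf_5e10' (hZ : NoRealZeroUpTo_5e10)
    {q : ℕ} [NeZero q] (hq : (10 ^ 6 : ℝ) < q) (hqQ : q ≤ 5 * 10 ^ 10)
    (χ : DirichletCharacter ℂ q) (hprim : χ.IsPrimitive) (hquad : χ.IsQuadratic) :
    1 / (1.502 * Real.log q) < (χ.LFunction 1).re :=
  lOne_gt_of_noRealZeroUpTo' hZ hq (by norm_num at hqQ ⊢; exact hqQ) χ hprim hquad

/-- The block-T3a leaf `NoRealZeroUpTo_6e10` (ENVELOPE-I milestone `6·10¹⁰`) gives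
`L(1, χ) > 1/(1.502 log q)` for `10⁶ < q ≤ 6·10¹⁰`. [cite: Hoffstein1980SiegelTatuzawa, Lemma 1 p. 168] -/
theorem lOne_gt_of_leaf_6e10' (hZ : NoRealZeroUpTo_6e10)
    {q : ℕ} [NeZero q] (hq : (10 ^ 6 : ℝ) < q) (hqQ : q ≤ 6 * 10 ^ 10)
    (χ : DirichletCharacter ℂ q) (hprim : χ.IsPrimitive) (hquad : χ.IsQuadratic) :
    1 / (1.502 * Real.log q) < (χ.LFunction 1).re :=
  lOne_gt_of_noRealZeroUpTo' hZ hq (by norm_num at hqQ ⊢; exact hqQ) χ hprim hquad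

/-- The block-T3b leaf `NoRealZeroUpTo_8e10` (ENVELOPE-I milestone `8·10¹⁰`) gives
`L(1, χ) > 1/(1.502 log q)` for `10⁶ < q ≤ 8·10¹⁰`. [cite: Hoffstein1980SiegelTatuzawa, Lemma 1 p. 168] -/
theorem lOne_gt_of_leaf_8e10' (hZ : NoRealZeroUpTo_8e10)
    {q : ℕ} [NeZero q] (hq : (10 ^ 6 : ℝ) < q) (hqQ : q ≤ 8 * 10 ^ 10)
    (χ : DirichletCharacter ℂ q) (hprim : χ.IsPrimitive) (hquad : χ.IsQuadratic) :
    1 / (1.502 * Real.log q) < (χ.LFunction 1).re :=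
  lOne_gt_of_noRealZeroUpTo' hZ hq (by norm_num at hqQ ⊢; exact hqQ) χ hprim hquad

/-- The block-T3c leaf `NoRealZeroUpTo_1e11` (ENVELOPE-I top `10¹¹`) gives
`L(1, χ) > 1/(1.502 log q)` for `10⁶ < q ≤ 10¹¹`. [cite: Hoffstein1980SiegelTatuzawa, Lemma 1 p. 168] -/
theorem lOne_gt_of_leaf_1e11' (hZ : NoRealZeroUpTo_1e11)
    {q : ℕ} [NeZero q] (hq : (10 ^ 6 : ℝ) < q) (hqQ : q ≤ 10 ^ 11)
    (χ : DirichletCharacter ℂ q) (hprim : χ.IsPrimitive) (hquad : χ.IsQuadratic) :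
    1 / (1.502 * Real.log q) < (χ.LFunction 1).re :=
  lOne_gt_of_noRealZeroUpTo' hZ hq (by norm_num at hqQ ⊢; exact hqQ) χ hprim hquad

/-- The odd block-T3c leaf `NoRealZeroOddUpTo_1e11` gives `L(1, χ) > 1/(1.502 log q)` for ODD primitive
quadratic `χ`, `10⁶ < q ≤ 10¹¹`. [cite: Hoffstein1980SiegelTatuzawa, Lemma 1 p. 168] -/
theorem lOne_gt_of_leaf_odd_1e11' (hZ : NoRealZeroOddUpTo_1e11)
    {q : ℕ} [NeZero q] (hq : (10 ^ 6 : ℝ) < q) (hqQ : q ≤ 10 ^ 11)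
    (χ : DirichletCharacter ℂ q) (hprim : χ.IsPrimitive) (hquad : χ.IsQuadratic) (hodd : χ.Odd) :
    1 / (1.502 * Real.log q) < (χ.LFunction 1).re :=
  lOne_gt_of_noRealZeroOddUpTo' hZ hq (by norm_num at hqQ ⊢; exact hqQ) χ hprim hquad hodd

/-- The even block-T3c leaf `NoRealZeroEvenUpTo_1e11` gives `L(1, χ) > 1/(1.502 log q)` for EVEN primitive
quadratic `χ`, `10⁶ < q ≤ 10¹¹`. [cite: Hoffstein1980SiegelTatuzawa, Lemma 1 p. 168] -/
theorem lOne_gt_of_leaf_even_1e11' (hZ : NoRealZeroEvenUpTo_1e11)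
    {q : ℕ} [NeZero q] (hq : (10 ^ 6 : ℝ) < q) (hqQ : q ≤ 10 ^ 11)
    (χ : DirichletCharacter ℂ q) (hprim : χ.IsPrimitive) (hquad : χ.IsQuadratic) (heven : χ.Even) :
    1 / (1.502 * Real.log q) < (χ.LFunction 1).re :=
  lOne_gt_of_noRealZeroEvenUpTo' hZ hq (by norm_num at hqQ ⊢; exact hqQ) χ hprim hquad heven

/-- Class-number form on the segment leaf at `4·10¹⁰` (booked level): `h_K > √|d_K|/(1.502 π log|d_K|)` for
imaginary quadratic `K` with `10⁶ < |d_K| ≤ 4·10¹⁰`, Hoffstein-free.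
[cite: Hoffstein1980SiegelTatuzawa, Lemma 1 p. 168 and (17) p. 173] -/
theorem classNumber_gt_of_leaf_4e10' (hZ : NoRealZeroUpTo_4e10)
    (K : Type) [Field K] [NumberField K] (h2 : Module.finrank ℚ K = 2)
    (hneg : NumberField.discr K < 0) (hd : (10 ^ 6 : ℝ) < (NumberField.discr K).natAbs)
    (hdQ : (NumberField.discr K).natAbs ≤ 4 * 10 ^ 10) :
    Real.sqrt (NumberField.discr K).natAbs / (1.502 * Real.pi * Real.log (NumberField.discr K).natAbs) <
      (NumberField.classNumber K : ℝ) :=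
  classNumber_gt_of_noRealZeroUpTo' hZ K h2 hneg hd (by norm_num at hdQ ⊢; exact hdQ)

/-- Class-number form on the segment leaf at `5·10¹⁰`: `h_K > √|d_K|/(1.502 π log|d_K|)` for imaginary
quadratic `K` with `10⁶ < |d_K| ≤ 5·10¹⁰`, Hoffstein-free.
[cite: Hoffstein1980SiegelTatuzawa, Lemma 1 p. 168 and (17) p. 173] -/
theorem classNumber_gt_of_leaf_5e10' (hZ : NoRealZeroUpTo_5e10)
    (K : Type) [Field K] [NumberField K] (h2 : Module.finrank ℚ K = 2)
    (hneg : NumberField.discr K < 0) (hd : (10 ^ 6 : ℝ) < (NumberField.discr K).natAbs)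
    (hdQ : (NumberField.discr K).natAbs ≤ 5 * 10 ^ 10) :
    Real.sqrt (NumberField.discr K).natAbs / (1.502 * Real.pi * Real.log (NumberField.discr K).natAbs) <
      (NumberField.classNumber K : ℝ) :=
  classNumber_gt_of_noRealZeroUpTo' hZ K h2 hneg hd (by norm_num at hdQ ⊢; exact hdQ)

/-- Class-number form on the block-T3a leaf at `6·10¹⁰`: `h_K > √|d_K|/(1.502 π log|d_K|)` for imaginary
quadratic `K` with `10⁶ < |d_K| ≤ 6·10¹⁰`, Hoffstein-free.
[cite: Hoffstein1980SiegelTatuzawa, Lemma 1 p. 168 and (17) p. 173] -/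
theorem classNumber_gt_of_leaf_6e10' (hZ : NoRealZeroUpTo_6e10)
    (K : Type) [Field K] [NumberField K] (h2 : Module.finrank ℚ K = 2)
    (hneg : NumberField.discr K < 0) (hd : (10 ^ 6 : ℝ) < (NumberField.discr K).natAbs)
    (hdQ : (NumberField.discr K).natAbs ≤ 6 * 10 ^ 10) :
    Real.sqrt (NumberField.discr K).natAbs / (1.502 * Real.pi * Real.log (NumberField.discr K).natAbs) <
      (NumberField.classNumber K : ℝ) :=
  classNumber_gt_of_noRealZeroUpTo' hZ K h2 hneg hd (by norm_num at hdQ ⊢; exact hdQ)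

/-- Class-number form on the block-T3b leaf at `8·10¹⁰`: `h_K > √|d_K|/(1.502 π log|d_K|)` for imaginary
quadratic `K` with `10⁶ < |d_K| ≤ 8·10¹⁰`, Hoffstein-free.
[cite: Hoffstein1980SiegelTatuzawa, Lemma 1 p. 168 and (17) p. 173] -/
theorem classNumber_gt_of_leaf_8e10' (hZ : NoRealZeroUpTo_8e10)
    (K : Type) [Field K] [NumberField K] (h2 : Module.finrank ℚ K = 2)
    (hneg : NumberField.discr K < 0) (hd : (10 ^ 6 : ℝ) < (NumberField.discr K).natAbs)
    (hdQ : (NumberField.discr K).natAbs ≤ 8 * 10 ^ 10) :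
    Real.sqrt (NumberField.discr K).natAbs / (1.502 * Real.pi * Real.log (NumberField.discr K).natAbs) <
      (NumberField.classNumber K : ℝ) :=
  classNumber_gt_of_noRealZeroUpTo' hZ K h2 hneg hd (by norm_num at hdQ ⊢; exact hdQ)

/-- Class-number form on the block-T3c leaf at `10¹¹`: `h_K > √|d_K|/(1.502 π log|d_K|)` for imaginary
quadratic `K` with `10⁶ < |d_K| ≤ 10¹¹`, Hoffstein-free.
[cite: Hoffstein1980SiegelTatuzawa, Lemma 1 p. 168 and (17) p. 173] -/
theorem classNumber_gt_of_leaf_1e11' (hZ : NoRealZeroUpTo_1e11)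
    (K : Type) [Field K] [NumberField K] (h2 : Module.finrank ℚ K = 2)
    (hneg : NumberField.discr K < 0) (hd : (10 ^ 6 : ℝ) < (NumberField.discr K).natAbs)
    (hdQ : (NumberField.discr K).natAbs ≤ 10 ^ 11) :
    Real.sqrt (NumberField.discr K).natAbs / (1.502 * Real.pi * Real.log (NumberField.discr K).natAbs) <
      (NumberField.classNumber K : ℝ) :=
  classNumber_gt_of_noRealZeroUpTo' hZ K h2 hneg hd (by norm_num at hdQ ⊢; exact hdQ)

end Literature.NumberTheory.LFunctions.SiegelTatuzawa

end
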